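import Mathlib
import HarnessLib
import Literature.MathematicalPhysics.QuantumFieldTheory.ConstructiveQFTWave0
import Summits.Ventures.LatticeQCDFlow.Scaling.Conjectures
import Summits.Ventures.LatticeQCDFlow.Scaling.LatticeGibbs

/-!
# LatticeQCDFlow / Scaling — (C2a): the degenerate instances are FALSE (no plaquettes; abelian group at `L = 1`)

HONEST FRAMING: exact (Metropolis-corrected) sampling algorithms for lattice gauge theory; figures of merit are
autocorrelation/cost numbers at stated couplings and volumes; no continuum-physics claim.

Venture `LatticeQCDFlow` (cell pub-lqcd), topic `Scaling`, FANOUT row 30 (lean-1) — OUR WORK; the negative edge of the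
conjecture item `Conjectures.ExactTransportBiLipschitz` ((C2a), THEORY-2.md §3.3), class MISSTATED (theory2 09:29Z:
the repaired statement C2a-R quantifies `∀ L, 2 ≤ L →` and is meant for `2 ≤ d`; the positive instances `U(N)`, `SU(N)`,
`N ≥ 2`, `d ≥ 2` are `Scaling/ExactTransportUN.lean`, `Scaling/ExactTransportSUN.lean`).

If at some volume `L` the Wilson action vanishes identically, the Wilson measure IS the product Haar measure, the
identity is a `1`-bi-Lipschitz exact transport, and `e^{cβ} ≤ 1` fails: `not_exactTransportBiLipschitz_of_action_zero`.
This happens (a) for `d ≤ 1` (no plaquettes) — `not_exactTransportBiLipschitz_of_le_one`, every `G`, `ρ`; (b) at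
`L = 1` for a commutative structure group (every plaquette holonomy is a commutator `aba⁻¹b⁻¹ = 1`) —
`not_exactTransportBiLipschitz_of_comm`, in particular for `U(1)`.  Elementary; nothing is cited as a fact.
-/

noncomputable section

namespace Summit.Ventures.LatticeQCDFlow.Theory2.Lattice

open MeasureTheory Literature.MathematicalPhysics.QuantumFieldTheory

section Degenerate

variable {N : ℕ} {G : Type} [Group G] [MetricSpace G] [IsTopologicalGroup G] [CompactSpace G]
  [MeasurableSpace G] [BorelSpace G] (ρ : G →* Matrix (Fin N) (Fin N) ℂ)

/-- If the Wilson action vanishes identically at volume `L`, the Wilson measure is the product Haar measure.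
[folklore] -/
theorem wilsonMeasure_eq_pi_of_action_zero {d L : ℕ} [NeZero L] (β : ℝ)
    (h0 : ∀ U : GaugeConfig d L G, wilsonAction ρ U = 0) :
    wilsonMeasure (d := d) (L := L) ρ β = Measure.pi fun _ : Edge d L => haarProbability G := by
  have hW : wilsonWeight (d := d) (L := L) ρ β = Measure.pi fun _ : Edge d L => haarProbability G := by
    unfold wilsonWeight
    have h1 : (fun U : GaugeConfig d L G => ENNReal.ofReal (Real.exp (-β * wilsonAction ρ U))) = 1 := by
      funext U; simp [h0 U]
    rw [h1, withDensity_one]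
  unfold wilsonMeasure partitionFunction
  rw [hW, measure_univ, inv_one, one_smul]

/-- **If the Wilson action vanishes identically at some volume, (C2a) fails**: the identity map is an exact
`1`-bi-Lipschitz transport there, for every `β`. [folklore] -/
theorem not_exactTransportBiLipschitz_of_action_zero {d : ℕ} (L : ℕ) [NeZero L]
    (h0 : ∀ U : GaugeConfig d L G, wilsonAction ρ U = 0) :
    ¬ Conjectures.ExactTransportBiLipschitz d N G ρ := by
  rintro ⟨c, hc, β₀, h⟩
  have h1 := h L (max β₀ 1) (le_max_left _ _) id 1 1 LipschitzWith.id AntilipschitzWith.id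
    (by rw [Measure.map_id]; exact (wilsonMeasure_eq_pi_of_action_zero ρ _ h0).symm)
  have h2 : (1 : ℝ) < Real.exp (c * max β₀ 1) :=
    Real.one_lt_exp_iff.2 (mul_pos hc (lt_of_lt_of_le one_pos (le_max_right _ _)))
  rw [NNReal.coe_one, mul_one] at h1
  linarith

omit [MetricSpace G] [IsTopologicalGroup G] [CompactSpace G] [MeasurableSpace G] [BorelSpace G] in
/-- In dimension `d ≤ 1` there are no plaquettes: the Wilson action vanishes. [folklore] -/
theorem wilsonAction_eq_zero_of_le_one {d : ℕ} (L : ℕ) [NeZero L] (hd : d ≤ 1) (U : GaugeConfig d L G) :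
    wilsonAction ρ U = 0 := by
  unfold wilsonAction
  have : IsEmpty {p : Fin d × Fin d // p.1 < p.2} :=
    ⟨fun p => by have h := p.2; have h1 := p.1.1.2; have h2 := p.1.2.2; omega⟩
  have : IsEmpty (Plaquette d L) := by unfold Plaquette; infer_instance
  exact Finset.sum_of_isEmpty _

/-- **(C2a) is false as typed for `d ≤ 1`** (every group, every representation). [folklore] -/
theorem not_exactTransportBiLipschitz_of_le_one {d : ℕ} (hd : d ≤ 1) :
    ¬ Conjectures.ExactTransportBiLipschitz d N G ρ :=
  not_exactTransportBiLipschitz_of_action_zero ρ 1 fun U => wilsonAction_eq_zero_of_le_one ρ 1 hd U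

omit [MetricSpace G] [IsTopologicalGroup G] [CompactSpace G] [MeasurableSpace G] [BorelSpace G] in
/-- At `L = 1` with a commutative structure group every plaquette holonomy is a trivial commutator, so the Wilson
action vanishes. [folklore] -/
theorem wilsonAction_eq_zero_of_comm {d : ℕ} (hc : ∀ a b : G, a * b = b * a) (U : GaugeConfig d 1 G) :
    wilsonAction ρ U = 0 := by
  unfold wilsonAction
  refine Finset.sum_eq_zero fun p _ => ?_
  have hx : ∀ y : Site d 1, y = p.1 := fun y => funext fun i => Subsingleton.elim _ _
  have hhol : plaquetteHolonomy U p.1 p.2.1.1 p.2.1.2 = 1 := by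
    unfold plaquetteHolonomy
    rw [hx (p.1.shift p.2.1.1), hx (p.1.shift p.2.1.2),
      hc (U (p.1, p.2.1.1)) (U (p.1, p.2.1.2)), mul_inv_cancel_right, mul_inv_cancel]
  rw [hhol, map_one, Matrix.trace_one, Fintype.card_fin]
  simp

/-- **(C2a) is false as typed for a commutative structure group** (witness volume `L = 1`), e.g. `U(1)`. [folklore] -/
theorem not_exactTransportBiLipschitz_of_comm {d : ℕ} (hc : ∀ a b : G, a * b = b * a) :
    ¬ Conjectures.ExactTransportBiLipschitz d N G ρ :=
  not_exactTransportBiLipschitz_of_action_zero ρ 1 fun U => wilsonAction_eq_zero_of_comm ρ hc U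

end Degenerate

end Summit.Ventures.LatticeQCDFlow.Theory2.Lattice

end
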